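import Mathlib
import Summits.ValiantsHypothesis.ValiantsHypothesis.Theorems.BarrierLeverPartitionMinorsHitByVPHiddenStatesCoStarTop

/-!
# Route BarrierLever — item `PartitionMinorsHitByVP` (stmt-ValiantsHypothesis-19717), line `hidden-states`:
# CO-STARS SERVE EVERY FAMILY WHOSE MISSING SETS ARE AFFINELY FREE — the exact dual of «free points serve anything»

Helper file (`--supports stmt-ValiantsHypothesis-19717`; cell valiant-natproofs, rung V4, 𝒟-side door (c), registered line
`Cruxes/PartitionMinorsHitByVP/Lines/hidden_states.lean` v7; prover seat val-np-p6 gen 10). Definition-free; closes NO item.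
Continues `…HiddenStatesCoStarTop` (p614189: the case of ONE missing row).

THE STATEMENT. Fix `h` and `c' + 1 ≤ h + 1` missing sets. The CO-STAR design is the single legal piece (K = h states) whose members are all
state sets except the top `univ` and the `c'` co-singletons `univ ∖ {qs j}`. Let `u` be ANY injective row family of size `2^h − (c'+1)`, and let
`s : Fin (c'+1) → Finset (Fin h)` enumerate the rows it misses. If the missing rows are AFFINELY INDEPENDENT as 0/1 points — witnessed by
coordinates `a : Fin c' → Fin h` with `det [𝟙 ; ([a j ∈ s l])_{j,l}] ≠ 0` — then the co-star design has a nonsingular design matrix for `u`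
(`coStar_exists_table_of_indep`), with the EXPLICIT table «base 𝟙, state `q ↦ e_{π q}`» for a permutation `π` with `π (qs j) = a j`.

WHY (dual Kronecker argument, as in `CoStar.det_coStarTop_ne_zero`). With that table the design matrix is the Kronecker power
`W = (1 1; 1 2)^{⊗h}` with the rows `s l` and the columns `univ`, `univ ∖ {a j}` deleted. A kernel vector extends to `β` with `Wβ` supported on the
missing rows; `β = W⁻¹(Wβ)` and `β` vanishes on the missing columns; the rows `univ`, `univ ∖ {a j}` of the explicit inverse `W⁻¹ = (2 −1; −1 1)^{⊗h}`
restricted to the columns `s l` are `σ_l · (1, −(2 − [a j ∈ s l]))`, `σ_l = ±1`, so the vanishing says `[𝟙; [a j ∈ s l]] · (σ_l (Wβ)(s l))_l = 0`,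
whence `Wβ = 0`, `β = 0`: contradiction (`det_coStar_ne_zero_of_indep`).

SCOPE. `c' = 0` is p614189 (any single missing row). `c' = 1`: ANY two missing rows (two distinct 0/1 points are affinely independent; take `a 0`
in their symmetric difference) — `coStar_exists_table_pair`. In general the hypothesis holds for every family of `c'+1 ≤ h+1` missing sets in affinely
general position. For LOWER row families (missing family = an up-set) affine independence forces the missing up-set to be «top + co-singletons», i.e. the
tiling case — the lower content of the CO-STAR CONJECTURE (memo val-np-p6 g10 §9: the co-star serves EVERY family of its size; verified h ≤ 7) needs
non-permutation tables and stays open. WHAT THIS IS NOT: nothing on crux 14610 or VP ≠ VNP; the crux itself is unconditional at these co-sizes (`…Cosmall`).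
-/

set_option linter.dupNamespace false

namespace Summit.ValiantsHypothesis.ValiantsHypothesis.Theorems.BarrierLever.HiddenStates

open Finset Matrix

noncomputable section

namespace CoStar

variable {h : ℕ}

/-! ## 1. The rows `univ` and `univ ∖ {a₀}` of the explicit inverse -/

/-- Row `univ` of `W⁻¹`: `W⁻¹[univ, S] = ∏_{x ∉ S} (−1)`. -/
theorem winv_univ (S : Finset (Fin h)) :
    (∏ x ∈ S, (if x ∈ (Finset.univ : Finset (Fin h)) then (1 : ℂ) else -1)) *
      (∏ x ∈ Sᶜ, (if x ∈ (Finset.univ : Finset (Fin h)) then (-1 : ℂ) else 2))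
      = ∏ _x ∈ Sᶜ, (-1 : ℂ) := by
  rw [Finset.prod_congr rfl fun x _ => if_pos (Finset.mem_univ x), Finset.prod_const_one, one_mul]
  exact Finset.prod_congr rfl fun x _ => if_pos (Finset.mem_univ x)

/-- Row `univ ∖ {a₀}` of `W⁻¹`: `W⁻¹[univ ∖ {a₀}, S] = −(2 − [a₀ ∈ S]) · ∏_{x ∉ S} (−1)`. -/
theorem winv_erase (a₀ : Fin h) (S : Finset (Fin h)) :
    (∏ x ∈ S, (if x ∈ (Finset.univ : Finset (Fin h)).erase a₀ then (1 : ℂ) else -1)) *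
      (∏ x ∈ Sᶜ, (if x ∈ (Finset.univ : Finset (Fin h)).erase a₀ then (-1 : ℂ) else 2))
      = -((2 : ℂ) - (if a₀ ∈ S then 1 else 0)) * ∏ _x ∈ Sᶜ, (-1 : ℂ) := by
  classical
  have hmem : ∀ x : Fin h, x ∈ (Finset.univ : Finset (Fin h)).erase a₀ ↔ x ≠ a₀ := by
    intro x; simp
  by_cases ha : a₀ ∈ S
  · -- first product: −1 (at a₀), second: all −1
    have h1 : ∏ x ∈ S, (if x ∈ (Finset.univ : Finset (Fin h)).erase a₀ then (1 : ℂ) else -1) = -1 := by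
      rw [← Finset.mul_prod_erase S _ ha, if_neg (by simp)]
      rw [Finset.prod_congr rfl fun x hx => if_pos ((hmem x).mpr (Finset.ne_of_mem_erase hx)), Finset.prod_const_one]
      ring
    have h2 : ∏ x ∈ Sᶜ, (if x ∈ (Finset.univ : Finset (Fin h)).erase a₀ then (-1 : ℂ) else 2) = ∏ _x ∈ Sᶜ, (-1 : ℂ) := by
      refine Finset.prod_congr rfl fun x hx => if_pos ((hmem x).mpr ?_)
      rintro rfl; exact (Finset.mem_compl.mp hx) ha
    rw [h1, h2, if_pos ha]; ring
  · have ha' : a₀ ∈ Sᶜ := Finset.mem_compl.mpr ha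
    have h1 : ∏ x ∈ S, (if x ∈ (Finset.univ : Finset (Fin h)).erase a₀ then (1 : ℂ) else -1) = 1 := by
      refine (Finset.prod_congr rfl fun x hx => if_pos ((hmem x).mpr ?_)).trans Finset.prod_const_one
      rintro rfl; exact ha hx
    have h2 : ∏ x ∈ Sᶜ, (if x ∈ (Finset.univ : Finset (Fin h)).erase a₀ then (-1 : ℂ) else 2)
        = 2 * ∏ _x ∈ Sᶜ.erase a₀, (-1 : ℂ) := by
      rw [← Finset.mul_prod_erase Sᶜ _ ha', if_neg (by simp)]
      congr 1
      exact Finset.prod_congr rfl fun x hx => if_pos ((hmem x).mpr (Finset.ne_of_mem_erase hx))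
    have h3 : ∏ _x ∈ Sᶜ, (-1 : ℂ) = (-1) * ∏ _x ∈ Sᶜ.erase a₀, (-1 : ℂ) := (Finset.mul_prod_erase Sᶜ _ ha').symm
    rw [h1, h2, h3, if_neg ha]; ring

/-! ## 2. The co-star determinant for affinely independent missing rows -/

/-- **Co-star minor for affinely free missing rows.** Rows `u` (injective) miss exactly the `c'+1` sets `s l`; columns `cols` (injective) avoid the top
and the co-singletons `univ ∖ {a j}`; the `(c'+1) × (c'+1)` matrix `[𝟙 ; [a j ∈ s l]]` is nonsingular. Then
`det [∏_{x ∈ u i}(if x ∈ cols k then 2 else 1)] ≠ 0`. -/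
theorem det_coStar_ne_zero_of_indep {r c' : ℕ} (u : Fin r → Finset (Fin h)) (hu : Function.Injective u)
    (s : Fin (c' + 1) → Finset (Fin h)) (hs : Function.Injective s) (hus : ∀ i l, u i ≠ s l) (hr : r + (c' + 1) = 2 ^ h)
    (cols : Fin r → Finset (Fin h)) (hcols : Function.Injective cols) (a : Fin c' → Fin h)
    (hcu : ∀ k, cols k ≠ Finset.univ) (hca : ∀ k j, cols k ≠ Finset.univ.erase (a j))
    (hN : (Matrix.of fun l i : Fin (c' + 1) =>
      (Fin.cases (1 : ℂ) (fun j => if a j ∈ s i then 1 else 0) l : ℂ)).det ≠ 0) :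
    (Matrix.of fun i k : Fin r => ∏ x ∈ u i, (if x ∈ cols k then (2 : ℂ) else 1)).det ≠ 0 := by
  classical
  let W : Matrix (Finset (Fin h)) (Finset (Fin h)) ℂ := fun S J => ∏ x ∈ S, (if x ∈ J then (2 : ℂ) else 1)
  let Wi : Matrix (Finset (Fin h)) (Finset (Fin h)) ℂ := fun J S =>
    (∏ x ∈ S, (if x ∈ J then (1 : ℂ) else -1)) * (∏ x ∈ Sᶜ, (if x ∈ J then (-1 : ℂ) else 2))
  have hWiW : Wi * W = 1 := by
    ext J J'
    rw [Matrix.mul_apply, Matrix.one_apply]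
    exact coStar_inv_mul J J'
  -- the rows not hit by `u` are exactly the `s l`
  have himg : Finset.univ \ Finset.univ.image u = Finset.univ.image s := by
    symm
    apply Finset.eq_of_subset_of_card_le
    · intro S hS
      obtain ⟨l, -, rfl⟩ := Finset.mem_image.mp hS
      rw [Finset.mem_sdiff]
      refine ⟨Finset.mem_univ _, fun hm => ?_⟩
      obtain ⟨i, -, hi⟩ := Finset.mem_image.mp hm
      exact hus i l hi
    · rw [Finset.card_sdiff_of_subset (Finset.subset_univ _), Finset.card_univ, Fintype.card_finset, Fintype.card_fin,
        Finset.card_image_of_injective _ hu, Finset.card_image_of_injective _ hs, Finset.card_univ, Fintype.card_fin,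
        Finset.card_univ, Fintype.card_fin]
      omega
  have hother : ∀ S, S ∉ Finset.univ.image s → ∃ i, u i = S := by
    intro S hS
    by_contra hno
    push Not at hno
    apply hS
    rw [← himg, Finset.mem_sdiff]
    refine ⟨Finset.mem_univ _, fun hm => ?_⟩
    obtain ⟨i, -, hi⟩ := Finset.mem_image.mp hm
    exact hno i hi
  -- suppose singular: kernel vector
  intro hdet
  obtain ⟨α, hαne, hα⟩ := Matrix.exists_mulVec_eq_zero_iff.mpr hdet
  let β : Finset (Fin h) → ℂ := fun J => ∑ k : Fin r, if cols k = J then α k else 0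
  have hβc : ∀ k, β (cols k) = α k := by
    intro k
    simp only [β]
    rw [Finset.sum_eq_single k]
    · simp
    · intro k' _ hk'
      rw [if_neg]
      exact fun hh => hk' (hcols hh)
    · intro hk; exact absurd (Finset.mem_univ k) hk
  have hβ0 : ∀ J, (∀ k, cols k ≠ J) → β J = 0 := by
    intro J hJ
    simp only [β]
    exact Finset.sum_eq_zero fun k _ => if_neg (hJ k)
  set γ : Finset (Fin h) → ℂ := W.mulVec β with hγ
  have hγu : ∀ i, γ (u i) = 0 := by
    intro i
    have hi := congrFun hα i
    simp only [Matrix.mulVec, dotProduct, Matrix.of_apply, Pi.zero_apply] at hi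
    rw [hγ]
    simp only [Matrix.mulVec, dotProduct, W, β]
    rw [show (∑ J : Finset (Fin h), (∏ x ∈ u i, if x ∈ J then (2 : ℂ) else 1) * ∑ k : Fin r, (if cols k = J then α k else 0))
        = ∑ k : Fin r, (∏ x ∈ u i, if x ∈ cols k then (2 : ℂ) else 1) * α k from ?_]
    · exact hi
    rw [show (∑ J : Finset (Fin h), (∏ x ∈ u i, if x ∈ J then (2 : ℂ) else 1) * ∑ k : Fin r, (if cols k = J then α k else 0))
        = ∑ J : Finset (Fin h), ∑ k : Fin r,
            (if cols k = J then (∏ x ∈ u i, if x ∈ cols k then (2 : ℂ) else 1) * α k else 0) from ?_]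
    · rw [Finset.sum_comm]
      refine Finset.sum_congr rfl fun k _ => ?_
      rw [Finset.sum_ite_eq Finset.univ (cols k), if_pos (Finset.mem_univ _)]
    refine Finset.sum_congr rfl fun J _ => ?_
    rw [Finset.mul_sum]
    refine Finset.sum_congr rfl fun k _ => ?_
    by_cases hk : cols k = J
    · rw [if_pos hk, if_pos hk, hk]
    · rw [if_neg hk, if_neg hk, mul_zero]
  have hγS : ∀ S, S ∉ Finset.univ.image s → γ S = 0 := by
    intro S hS
    obtain ⟨i, hi⟩ := hother S hS
    rw [← hi]; exact hγu i
  -- β = W⁻¹ γ, and γ lives on the image of s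
  have hβ : ∀ J, β J = ∑ l : Fin (c' + 1), Wi J (s l) * γ (s l) := by
    intro J
    have h1 : (Wi.mulVec γ) J = β J := by
      rw [hγ, Matrix.mulVec_mulVec, hWiW, Matrix.one_mulVec]
    rw [← h1, Matrix.mulVec, dotProduct]
    rw [← Finset.sum_subset (Finset.subset_univ (Finset.univ.image s))]
    · rw [Finset.sum_image (fun l _ l' _ hll => hs hll)]
    · intro S _ hS
      rw [hγS S hS, mul_zero]
  -- the equations at the missing columns
  set δ : Fin (c' + 1) → ℂ := fun l => (∏ _x ∈ (s l)ᶜ, (-1 : ℂ)) * γ (s l) with hδ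
  have hE0 : ∑ l, δ l = 0 := by
    have h0 := hβ0 Finset.univ hcu
    rw [hβ] at h0
    have : ∀ l, δ l = Wi Finset.univ (s l) * γ (s l) := by
      intro l
      simp only [δ, Wi]
      rw [winv_univ]
    rw [Finset.sum_congr rfl fun l _ => this l]
    exact h0
  have hEj : ∀ j : Fin c', ∑ l, (if a j ∈ s l then (1 : ℂ) else 0) * δ l = 0 := by
    intro j
    have hj := hβ0 (Finset.univ.erase (a j)) (fun k => hca k j)
    rw [hβ] at hj
    have hj' : ∑ l, (-((2 : ℂ) - (if a j ∈ s l then 1 else 0))) * δ l = 0 := by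
      have : ∀ l, (-((2 : ℂ) - (if a j ∈ s l then 1 else 0))) * δ l = Wi (Finset.univ.erase (a j)) (s l) * γ (s l) := by
        intro l
        simp only [δ, Wi]
        rw [winv_erase]
        ring
      rw [Finset.sum_congr rfl fun l _ => this l]
      exact hj
    have : ∑ l, (if a j ∈ s l then (1 : ℂ) else 0) * δ l
        = ∑ l, (-((2 : ℂ) - (if a j ∈ s l then 1 else 0))) * δ l + 2 * ∑ l, δ l := by
      rw [Finset.mul_sum, ← Finset.sum_add_distrib]
      refine Finset.sum_congr rfl fun l _ => ?_
      ring
    rw [this, hj', hE0, mul_zero, add_zero]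
  -- the affine-independence matrix kills δ
  have hNδ : (Matrix.of fun l i : Fin (c' + 1) =>
      (Fin.cases (1 : ℂ) (fun j => if a j ∈ s i then 1 else 0) l : ℂ)).mulVec δ = 0 := by
    funext l
    rw [Matrix.mulVec, dotProduct, Pi.zero_apply]
    simp only [Matrix.of_apply]
    refine Fin.cases ?_ (fun j => ?_) l
    · simp only [Fin.cases_zero, one_mul]; exact hE0
    · simp only [Fin.cases_succ]; exact hEj j
  have hδ0 : δ = 0 := Matrix.eq_zero_of_mulVec_eq_zero hN hNδ
  have hγ0 : ∀ l, γ (s l) = 0 := by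
    intro l
    have := congrFun hδ0 l
    simp only [δ, Pi.zero_apply] at this
    rcases mul_eq_zero.mp this with h0 | h0
    · exact absurd h0 (Finset.prod_ne_zero_iff.mpr fun x _ => by norm_num)
    · exact h0
  apply hαne
  funext k
  rw [Pi.zero_apply, ← hβc k, hβ]
  exact Finset.sum_eq_zero fun l _ => by rw [hγ0 l, mul_zero]

/-! ## 3. The explicit permutation table -/

/-- **CO-STARS SERVE FAMILIES WITH AFFINELY FREE COMPLEMENT (numeric form).** One piece `p₀` with `K = h` states; the design's columns `c k` are
injective state sets avoiding the top and the co-singletons `univ ∖ {qs j}` (`qs` injective) and number `2^h − (c'+1)`; the row family `u` is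
injective and misses the sets `s l`, whose affine independence is witnessed by coordinates `a j` (injective) with `det [𝟙; [a j ∈ s l]] ≠ 0`.
Then some table makes the design matrix nonsingular. -/
theorem coStar_exists_table_of_indep {r c' m : ℕ} (p₀ : Fin m) (u : Fin r → Finset (Fin h)) (hu : Function.Injective u)
    (s : Fin (c' + 1) → Finset (Fin h)) (hs : Function.Injective s) (hus : ∀ i l, u i ≠ s l) (hr : r + (c' + 1) = 2 ^ h)
    (c : Fin r → Finset (Fin h)) (hc : Function.Injective c) (qs : Fin c' → Fin h) (hqs : Function.Injective qs)
    (hcu : ∀ k, c k ≠ Finset.univ) (hcq : ∀ k j, c k ≠ Finset.univ.erase (qs j))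
    (a : Fin c' → Fin h) (ha : Function.Injective a)
    (hN : (Matrix.of fun l i : Fin (c' + 1) =>
      (Fin.cases (1 : ℂ) (fun j => if a j ∈ s i then 1 else 0) l : ℂ)).det ≠ 0) :
    ∃ tx : Fin m → Option (Fin h) → Fin h → ℂ,
      (Matrix.of fun i k : Fin r =>
        ∏ x ∈ u i, (tx p₀ none x + ∑ q ∈ c k, tx p₀ (some q) x)).det ≠ 0 := by
  classical
  -- a permutation π of the states/coordinates with π (qs j) = a j
  let e₁ : {x : Fin h // x ∈ Set.range qs} ≃ Fin c' := (Equiv.ofInjective qs hqs).symm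
  let e₂ : Fin c' ≃ {x : Fin h // x ∈ Set.range a} := Equiv.ofInjective a ha
  let e : {x : Fin h // x ∈ Set.range qs} ≃ {x : Fin h // x ∈ Set.range a} := e₁.trans e₂
  let π : Equiv.Perm (Fin h) := e.extendSubtype
  have hπ : ∀ j, π (qs j) = a j := by
    intro j
    have hmem : qs j ∈ Set.range qs := ⟨j, rfl⟩
    have h1 := Equiv.extendSubtype_apply_of_mem e (qs j) hmem
    rw [h1]
    simp only [e, Equiv.trans_apply, e₂, Equiv.ofInjective_apply]
    congr 1
    simp only [e₁]
    apply (Equiv.ofInjective qs hqs).injective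
    rw [Equiv.apply_symm_apply]
    ext
    simp [Equiv.ofInjective_apply]
  refine ⟨fun _ o x => Option.elim o (1 : ℂ) fun q => if π q = x then 1 else 0, ?_⟩
  -- the columns after relabelling the states by π
  let cols : Fin r → Finset (Fin h) := fun k => (c k).map π.toEmbedding
  have hentry : ∀ (k : Fin r) (x : Fin h),
      ((1 : ℂ) + ∑ q ∈ c k, (if π q = x then (1 : ℂ) else 0)) = if x ∈ cols k then 2 else 1 := by
    intro k x
    have hsum : ∑ q ∈ c k, (if π q = x then (1 : ℂ) else 0) = if x ∈ cols k then 1 else 0 := by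
      rw [Finset.sum_ite, Finset.sum_const_zero, add_zero, Finset.sum_const, nsmul_eq_mul, mul_one]
      by_cases hx : x ∈ cols k
      · rw [if_pos hx]
        obtain ⟨q, hq, hqx⟩ := Finset.mem_map.mp hx
        have : (c k).filter (fun q => π q = x) = {q} := by
          ext q'
          simp only [Finset.mem_filter, Finset.mem_singleton]
          constructor
          · rintro ⟨_, h'⟩
            apply π.injective
            rw [h']; exact hqx.symm
          · rintro rfl; exact ⟨hq, hqx⟩
        rw [this, Finset.card_singleton]; norm_num
      · rw [if_neg hx]
        have : (c k).filter (fun q => π q = x) = ∅ := by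
          rw [Finset.filter_eq_empty_iff]
          intro q hq hqx
          exact hx (Finset.mem_map.mpr ⟨q, hq, hqx⟩)
        rw [this, Finset.card_empty]; norm_num
    rw [hsum]
    by_cases hx : x ∈ cols k
    · rw [if_pos hx, if_pos hx]; norm_num
    · rw [if_neg hx, if_neg hx]; norm_num
  have hmat : (Matrix.of fun i k : Fin r =>
      ∏ x ∈ u i, ((1 : ℂ) + ∑ q ∈ c k, (if π q = x then (1 : ℂ) else 0)))
      = Matrix.of fun i k : Fin r => ∏ x ∈ u i, (if x ∈ cols k then (2 : ℂ) else 1) := by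
    ext i k
    simp only [Matrix.of_apply]
    exact Finset.prod_congr rfl fun x _ => hentry k x
  simp only [Option.elim]
  rw [hmat]
  -- hypotheses of the determinant lemma for the relabelled columns
  have hcols : Function.Injective cols := by
    intro k k' hkk
    apply hc
    exact Finset.map_injective π.toEmbedding hkk
  have hmap_univ : (Finset.univ : Finset (Fin h)).map π.toEmbedding = Finset.univ :=
    Finset.map_univ_equiv π
  have hcolsu : ∀ k, cols k ≠ Finset.univ := by
    intro k hk
    apply hcu k
    apply Finset.map_injective π.toEmbedding
    rw [hmap_univ]; exact hk
  have hcolsa : ∀ k j, cols k ≠ Finset.univ.erase (a j) := by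
    intro k j hk
    apply hcq k j
    apply Finset.map_injective π.toEmbedding
    rw [Finset.map_erase, hmap_univ, Equiv.toEmbedding_apply, hπ j]
    exact hk
  exact det_coStar_ne_zero_of_indep u hu s hs hus hr cols hcols a hcolsu hcolsa hN

/-- **Any TWO missing rows** (`c' = 1`): the co-star «cube minus top minus one co-singleton» serves EVERY injective family of size `2^h − 2`
(two distinct sets differ at some coordinate `a₀`, and `det [1 1; [a₀ ∈ s 0] [a₀ ∈ s 1]] = ±1`). -/
theorem coStar_exists_table_pair {r m : ℕ} (p₀ : Fin m) (u : Fin r → Finset (Fin h)) (hu : Function.Injective u)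
    (hr : r + 2 = 2 ^ h) (c : Fin r → Finset (Fin h)) (hc : Function.Injective c) (q₀ : Fin h)
    (hcu : ∀ k, c k ≠ Finset.univ) (hcq : ∀ k, c k ≠ Finset.univ.erase q₀) :
    ∃ tx : Fin m → Option (Fin h) → Fin h → ℂ,
      (Matrix.of fun i k : Fin r =>
        ∏ x ∈ u i, (tx p₀ none x + ∑ q ∈ c k, tx p₀ (some q) x)).det ≠ 0 := by
  classical
  -- the two missing rows
  have hmiss : (Finset.univ \ Finset.univ.image u).card = 2 := by
    rw [Finset.card_sdiff_of_subset (Finset.subset_univ _), Finset.card_univ, Fintype.card_finset, Fintype.card_fin,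
      Finset.card_image_of_injective _ hu, Finset.card_univ, Fintype.card_fin]
    omega
  obtain ⟨S₀, S₁, hne, hS⟩ := Finset.card_eq_two.mp hmiss
  have hS₀ : S₀ ∈ Finset.univ \ Finset.univ.image u := by rw [hS]; simp
  have hS₁ : S₁ ∈ Finset.univ \ Finset.univ.image u := by rw [hS]; simp
  -- a coordinate where they differ
  obtain ⟨a₀, ha₀⟩ : ∃ a₀ : Fin h, ¬ (a₀ ∈ S₀ ↔ a₀ ∈ S₁) := by
    by_contra hall
    push Not at hall
    exact hne (Finset.ext hall)
  let s : Fin 2 → Finset (Fin h) := ![S₀, S₁]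
  have hs : Function.Injective s := by
    intro l l' hll
    fin_cases l <;> fin_cases l' <;> simp_all [s]
  have hus : ∀ i l, u i ≠ s l := by
    intro i l hil
    have hmem : u i ∈ Finset.univ.image u := Finset.mem_image_of_mem u (Finset.mem_univ i)
    rw [hil] at hmem
    have hnot : s l ∉ Finset.univ.image u := by
      have hin : s l ∈ Finset.univ \ Finset.univ.image u := by
        rw [hS]
        fin_cases l <;> simp [s]
      exact (Finset.mem_sdiff.mp hin).2
    exact hnot hmem
  refine coStar_exists_table_of_indep p₀ u hu s hs hus hr c hc ![q₀] (fun i j hij => Subsingleton.elim _ _) hcu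
    (fun k j => by fin_cases j; simpa using hcq k) ![a₀] (fun i j hij => Subsingleton.elim _ _) ?_
  -- det [1 1; [a₀∈S₀] [a₀∈S₁]] ≠ 0
  have hM : (Matrix.of fun l i : Fin (1 + 1) =>
      (Fin.cases (1 : ℂ) (fun j => if (![a₀] : Fin 1 → Fin h) j ∈ s i then 1 else 0) l : ℂ))
      = !![(1 : ℂ), 1; (if a₀ ∈ S₀ then 1 else 0), (if a₀ ∈ S₁ then 1 else 0)] := by
    ext l i
    fin_cases l <;> fin_cases i <;> rfl
  rw [hM, Matrix.det_fin_two_of]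
  by_cases hx0 : a₀ ∈ S₀ <;> by_cases hx1 : a₀ ∈ S₁ <;> simp [hx0, hx1] at ha₀ ⊢

end CoStar

end

end Summit.ValiantsHypothesis.ValiantsHypothesis.Theorems.BarrierLever.HiddenStates
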